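import Literature.Combinatorics.StablePolynomials.Basic
import HarnessLib

/-!
# Inversion of one variable preserves stability (Borcea–Brändén I, Lemma 1.7 (3))

J. Borcea, P. Brändén, *The Lee–Yang and Pólya–Schur programs. I. Linear operators preserving stability*,
Invent. Math. 177 (2009) 541–569 (arXiv:0809.0401), §1:

> **Lemma 1.7.** Let `𝕂 = ℝ` or `ℂ` and `f ∈ 𝓗_n(𝕂)` be of degree `d_j` in `z_j`, `1 ≤ j ≤ n`. Then for any
> `1 ≤ i ≤ n` one has: … (3) `z_i^{d_i} f(z_1,…,z_{i-1},-z_i^{-1},z_{i+1},…,z_n) ∈ 𝓗_n(𝕂)`; …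

Parts (1) (real specialisation, "stable or `0`"), (2) (positive scaling) and (4) (identifying two variables) are in
the tree (`IsUpperHalfPlaneStable.specialize_real` in `Limits.lean`, `.diagScale` and `.identify` in `Basic.lean`).
This file supplies (3): the polynomial `z_i^d f(…,-z_i^{-1},…)` for any `d ≥ deg_{z_i} f` (`invertVar i d f`;
`d = d_i` is the printed case, larger `d` multiplies by a power of `z_i`), its evaluation (`eval_invertVar`), and
its stability over `ℂ` and over `ℝ` — because `w ↦ -1/w` maps the open upper half-plane onto itself.

## Contents

* `invertVar i d f`; `invertVar_zero`, `map_invertVar`, `eval_invertVar`, `degreeOf_invertVar_le`.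
* **`IsUpperHalfPlaneStable.invertVar`** (Lemma 1.7 (3), `𝕂 = ℂ`), **`IsRealStable.invertVar`** (`𝕂 = ℝ`).

## References

* [BorceaBranden2009] J. Borcea, P. Brändén, Invent. Math. 177 (2009) 541–569, §1 Lemma 1.7 (3).
-/

noncomputable section

open MvPolynomial Finset

namespace Literature.Combinatorics.StablePolynomials

variable {σ : Type*}

/-! ## §1 The inverted polynomial -/

section Def

variable {R : Type*} [CommRing R]

/-- **`z_i^d f(z_1,…,-z_i^{-1},…,z_n)`** as a polynomial (`d ≥ deg_{z_i} f`): the monomial `c z^s` of `f` becomes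
`(-1)^{s_i} c z^{s'}` with `s'_i = d - s_i` and `s'_j = s_j` for `j ≠ i`. [cite: BorceaBranden2009, §1 Lemma 1.7 (3)] -/
def invertVar (i : σ) (d : ℕ) (f : MvPolynomial σ R) : MvPolynomial σ R :=
  ∑ s ∈ f.support, monomial (s.update i (d - s i)) ((-1) ^ s i * coeff s f)

/-- `invertVar` of `0` is `0`. [cite: BorceaBranden2009, §1 Lemma 1.7 (3)] -/
theorem invertVar_zero (i : σ) (d : ℕ) : invertVar i d (0 : MvPolynomial σ R) = 0 := by
  rw [invertVar, support_zero, sum_empty]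

/-- **`invertVar` commutes with injective changes of coefficients** (e.g. `ℝ ⊆ ℂ`).
[cite: BorceaBranden2009, §1 Lemma 1.7 (3) (`𝕂 = ℝ` or `ℂ`)] -/
theorem map_invertVar {S : Type*} [CommRing S] {φ : R →+* S} (hφ : Function.Injective φ) (i : σ) (d : ℕ)
    (f : MvPolynomial σ R) : map φ (invertVar i d f) = invertVar i d (map φ f) := by
  rw [invertVar, invertVar, _root_.map_sum, support_map_of_injective _ hφ]
  refine sum_congr rfl fun s _ => ?_
  rw [map_monomial, _root_.map_mul, _root_.map_pow, _root_.map_neg, _root_.map_one, coeff_map]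

end Def

/-! ## §2 Evaluation and degree -/

section Eval

variable [Fintype σ] [DecidableEq σ]

/-- `w^d (-1/w)^k = (-1)^k w^{d-k}` for `k ≤ d`, `w ≠ 0`. [folklore] -/
private theorem pow_mul_neg_inv_pow' {K : Type*} [Field K] {w : K} (hw : w ≠ 0) {k d : ℕ} (h : k ≤ d) :
    w ^ d * (-w⁻¹) ^ k = (-1) ^ k * w ^ (d - k) := by
  obtain ⟨e, rfl⟩ := Nat.exists_eq_add_of_le h
  rw [Nat.add_sub_cancel_left, pow_add, neg_pow, inv_pow, mul_comm (w ^ k) (w ^ e), mul_assoc,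
    mul_left_comm (w ^ k), mul_inv_cancel₀ (pow_ne_zero _ hw), mul_one, mul_comm]

/-- **`(invertVar i d f)(z) = z_i^d · f(z_1,…,-z_i^{-1},…,z_n)`** for `z_i ≠ 0` and `d ≥ deg_{z_i} f`.
[cite: BorceaBranden2009, §1 Lemma 1.7 (3)] -/
theorem eval_invertVar {K : Type*} [Field K] (i : σ) {d : ℕ} {f : MvPolynomial σ K} (hd : degreeOf i f ≤ d)
    {z : σ → K} (hz : z i ≠ 0) :
    eval z (invertVar i d f) = z i ^ d * eval (Function.update z i (-(z i)⁻¹)) f := by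
  rw [invertVar, _root_.map_sum, eval_eq' (Function.update z i (-(z i)⁻¹)) f, mul_sum]
  refine sum_congr rfl fun s hs => ?_
  have hsi : s i ≤ d := (monomial_le_degreeOf i hs).trans hd
  rw [eval_monomial, Finsupp.prod_pow, ← Finset.mul_prod_erase univ _ (mem_univ i),
    ← Finset.mul_prod_erase univ (fun j => Function.update z i (-(z i)⁻¹) j ^ s j) (mem_univ i)]
  have h1 : ∏ j ∈ univ.erase i, z j ^ (s.update i (d - s i)) j = ∏ j ∈ univ.erase i, z j ^ s j :=
    prod_congr rfl fun j hj => by rw [Finsupp.update_apply, if_neg (ne_of_mem_erase hj)]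
  have h2 : ∏ j ∈ univ.erase i, Function.update z i (-(z i)⁻¹) j ^ s j = ∏ j ∈ univ.erase i, z j ^ s j :=
    prod_congr rfl fun j hj => by rw [Function.update_of_ne (ne_of_mem_erase hj)]
  rw [h1, h2, Finsupp.update_apply, if_pos rfl, Function.update_self]
  have key := pow_mul_neg_inv_pow' hz hsi
  linear_combination (coeff s f * ∏ j ∈ univ.erase i, z j ^ s j) * key.symm

omit [Fintype σ] in
/-- **`deg_{z_i} (z_i^d f(…,-z_i^{-1},…)) ≤ d`.** [cite: BorceaBranden2009, §1 Lemma 1.7 (3)] -/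
theorem degreeOf_invertVar_le {R : Type*} [CommRing R] (i : σ) (d : ℕ) (f : MvPolynomial σ R) :
    degreeOf i (invertVar i d f) ≤ d := by
  rw [degreeOf_le_iff]
  intro m hm
  rw [invertVar] at hm
  obtain ⟨s, -, hs⟩ := Finset.mem_biUnion.1 (support_sum hm)
  rw [Finset.mem_singleton.1 (support_monomial_subset hs), Finsupp.update_apply, if_pos rfl]
  exact Nat.sub_le _ _

end Eval

/-! ## §3 Lemma 1.7 (3) -/

section Stable

variable [Fintype σ] [DecidableEq σ]

/-- **Borcea–Brändén I, Lemma 1.7 (3), `𝕂 = ℂ`**: if `f` is stable and `d ≥ deg_{z_i} f` then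
`z_i^d f(z_1,…,-z_i^{-1},…,z_n)` is stable (`-1/w` lies in the open upper half-plane when `w` does).
[cite: BorceaBranden2009, §1 Lemma 1.7 (3)] -/
theorem IsUpperHalfPlaneStable.invertVar {f : MvPolynomial σ ℂ} (hf : IsUpperHalfPlaneStable f) (i : σ) {d : ℕ}
    (hd : degreeOf i f ≤ d) : IsUpperHalfPlaneStable (invertVar i d f) := by
  intro z hz
  have hzi : z i ≠ 0 := fun h => by
    have := hz i
    rw [h, Complex.zero_im] at this
    exact lt_irrefl _ this
  rw [eval_invertVar i hd hzi]
  refine mul_ne_zero (pow_ne_zero _ hzi) (hf _ fun j => ?_)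
  by_cases hj : j = i
  · subst hj
    rw [Function.update_self, Complex.neg_im, Complex.inv_im, neg_div, neg_neg]
    exact div_pos (hz j) (Complex.normSq_pos.2 hzi)
  · rw [Function.update_of_ne hj]
    exact hz j

omit [Fintype σ] [DecidableEq σ] in
/-- Degrees are unchanged by complexification. [folklore] -/
private theorem degreeOf_map_algebraMap (i : σ) (f : MvPolynomial σ ℝ) :
    degreeOf i (map (algebraMap ℝ ℂ) f) = degreeOf i f := by
  classical
  rw [degreeOf_eq_sup, degreeOf_eq_sup, support_map_of_injective _ (algebraMap ℝ ℂ).injective]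

/-- **Borcea–Brändén I, Lemma 1.7 (3), `𝕂 = ℝ`**: if `f` is real stable and `d ≥ deg_{z_i} f` then
`z_i^d f(z_1,…,-z_i^{-1},…,z_n)` is real stable. [cite: BorceaBranden2009, §1 Lemma 1.7 (3)] -/
theorem IsRealStable.invertVar {f : MvPolynomial σ ℝ} (hf : IsRealStable f) (i : σ) {d : ℕ}
    (hd : degreeOf i f ≤ d) : IsRealStable (invertVar i d f) := by
  unfold IsRealStable
  rw [map_invertVar (algebraMap ℝ ℂ).injective]
  exact IsUpperHalfPlaneStable.invertVar hf i (by rw [degreeOf_map_algebraMap]; exact hd)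

end Stable

end Literature.Combinatorics.StablePolynomials

end
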